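import Summits.Ventures.PercRepro.C026PFunMerge
import Summits.Ventures.PercRepro.C026PFunMono

/-!
# Half-monotonicity of the (P) functional and THEOREM R (p6, gen 16; mine-3 §29 (b)–(c))

For an edge `e ∈ F` put `Φ_e(K) := (P_F)(K) − ½·(P_{F − e})(K)`.  **LEMMA (§29 (b))**: `Φ_e` is
nondecreasing in the vertex `K`-cells (`pFun_halfEM_mono`, stated in the product order of the
`K`-vectors).  The `K`-part of `(P_F)` is `∑_{ω ⊆ F} K_c(ω)·n̄(ω^c)`; splitting `ω ⊆ F` by `e`,
the configurations with `e` closed are exactly those of `F − e`, with the same `K_c(ω)` and with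
`n̄(ω^c ∪ e) ≥ ½·n̄(ω^c)` by the merge lemma, while the configurations with `e` open contribute
`≥ 0` — so the `K`-increment of `(P_F)` is at least half the `K`-increment of `(P_{F − e})`.

**THEOREM R (§29 (c))**: if `(P_F) ≥ (P_{F − e})` at every lower-corner state (`K = K_min(x)`)
for every `F` and `e ∈ F` (`EMCorner`), then `(P_F) ≥ 0` for every `F` and every band state
(`x ∈ [0, 1]`, `K ≥ K_min(x)`) — induction on `F`: at the corner `Φ_e ≥ ½(P_{F − e}) ≥ 0`, and
`Φ_e` only grows when the `K`-cells are raised from the corner (`K`-monotonicity itself is in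
`C026PFunMono`).  Also the Δ-form of `(P)` (mine-3 §29 (a)).
-/

namespace PercRepro

namespace MultiGraph

open Finset

variable {V E : Type*} [Fintype V] [DecidableEq V] [Fintype E] [DecidableEq E]
  {G : MultiGraph V E}

omit [Fintype V] [DecidableEq V] in
/-- The configurations inside `F` with `e` closed are the configurations inside `F − e`. -/
theorem configsIn_filter_eq_false {F : Finset E} {e : E} :
    (configsIn F).filter (fun ω : Config E => ω e = false) = configsIn (F.erase e) := by
  ext ω
  rw [Finset.mem_filter, mem_configsIn, mem_configsIn]
  constructor
  · rintro ⟨h, he⟩ f hf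
    refine Finset.mem_erase.2 ⟨?_, h f hf⟩
    rintro rfl
    rw [he] at hf
    exact absurd hf (by decide)
  · intro h
    refine ⟨fun f hf => Finset.mem_of_mem_erase (h f hf), ?_⟩
    by_contra hne
    have : ω e = true := by
      cases hω : ω e
      · exact absurd hω hne
      · rfl
    exact absurd (Finset.ne_of_mem_erase (h e this)) (fun h' => h' rfl)

omit [Fintype V] [DecidableEq V] in
/-- For `ω ⊆ F − e` with `e ∈ F`, the complement of `ω` inside `F` is the complement inside
`F − e` with `e` opened. -/
theorem complIn_eq_update_of_mem {F : Finset E} {e : E} (he : e ∈ F) {ω : Config E}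
    (hω : ω ∈ configsIn (F.erase e)) :
    complIn F ω = Function.update (complIn (F.erase e) ω) e true := by
  have hωe : ω e = false := by
    by_contra hne
    have : ω e = true := by
      cases hω' : ω e
      · exact absurd hω' hne
      · rfl
    exact absurd (Finset.ne_of_mem_erase ((mem_configsIn.1 hω) e this)) (fun h' => h' rfl)
  funext f
  by_cases hf : f = e
  · subst hf
    simp [complIn, he, hωe]
  · simp [complIn, Finset.mem_erase, hf]

omit [Fintype V] [DecidableEq V] in
/-- No open edge of a configuration inside `∅`: it is the all-closed configuration. -/
theorem configsIn_empty : configsIn (∅ : Finset E) = {fun _ => false} := by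
  ext ω
  rw [mem_configsIn, Finset.mem_singleton]
  constructor
  · intro h
    funext f
    cases hf : ω f
    · rfl
    · exact absurd (h f hf) (Finset.notMem_empty f)
  · rintro rfl f hf
    exact absurd hf Bool.false_ne_true

/-! ### The half-monotonicity lemma -/

/-- The `K`-increment of the `K`-part of `(P_F)` is at least half that of `(P_{F − e})`
(mine-3 §29 (b), product-order form). -/
theorem pFunK_sub_le_two_mul {c : V} {x K K₀ : V → ℝ} (hx : ∀ v, 0 ≤ x v ∧ x v ≤ 1)
    (hK₀ : ∀ v, 0 ≤ K₀ v) (hKK : ∀ v, K₀ v ≤ K v) {F : Finset E} {e : E} (he : e ∈ F) :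
    G.pFunK c x K (F.erase e) - G.pFunK c x K₀ (F.erase e) ≤
      2 * (G.pFunK c x K F - G.pFunK c x K₀ F) := by
  rw [pFunK_sub_pFunK, pFunK_sub_pFunK, Finset.mul_sum]
  rw [← Finset.sum_filter_add_sum_filter_not (configsIn F) (fun ω : Config E => ω e = false),
    configsIn_filter_eq_false]
  have hD : ∀ ω, 0 ≤ G.kCluster K c ω - G.kCluster K₀ c ω := fun ω =>
    sub_nonneg.2 (kCluster_mono hK₀ hKK c ω)
  have h2 : 0 ≤ ∑ ω ∈ (configsIn F).filter (fun ω : Config E => ¬ ω e = false),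
      2 * ((G.kCluster K c ω - G.kCluster K₀ c ω) * G.nbar x (complIn F ω)) :=
    Finset.sum_nonneg fun ω _ => mul_nonneg zero_le_two (mul_nonneg (hD ω) (nbar_nonneg hx _))
  refine le_trans ?_ (le_add_of_nonneg_right h2)
  refine Finset.sum_le_sum fun ω hω => ?_
  rw [complIn_eq_update_of_mem he hω]
  have hmerge := nbar_le_two_mul_nbar_update_true (G := G) hx (complIn (F.erase e) ω) e
  calc (G.kCluster K c ω - G.kCluster K₀ c ω) * G.nbar x (complIn (F.erase e) ω)
      ≤ (G.kCluster K c ω - G.kCluster K₀ c ω) *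
          (2 * G.nbar x (Function.update (complIn (F.erase e) ω) e true)) :=
        mul_le_mul_of_nonneg_left hmerge (hD ω)
    _ = 2 * ((G.kCluster K c ω - G.kCluster K₀ c ω) *
          G.nbar x (Function.update (complIn (F.erase e) ω) e true)) := by ring

/-- **LEMMA (mine-3 §29 (b), half-monotonicity)**: `Φ_e(K) = (P_F)(K) − ½(P_{F − e})(K)` is
nondecreasing in the `K`-cells (product order; cells in `[0, 1]`, `K`-cells `≥ 0`). -/
theorem pFun_halfEM_mono {c : V} {x K K₀ : V → ℝ} (hx : ∀ v, 0 ≤ x v ∧ x v ≤ 1)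
    (hK₀ : ∀ v, 0 ≤ K₀ v) (hKK : ∀ v, K₀ v ≤ K v) {F : Finset E} {e : E} (he : e ∈ F) :
    G.pFun c x K₀ F - G.pFun c x K₀ (F.erase e) / 2 ≤
      G.pFun c x K F - G.pFun c x K (F.erase e) / 2 := by
  have h := pFunK_sub_le_two_mul (G := G) (c := c) hx hK₀ hKK he
  rw [pFun_eq_pFunLin_add_pFunK, pFun_eq_pFunLin_add_pFunK, pFun_eq_pFunLin_add_pFunK,
    pFun_eq_pFunLin_add_pFunK]
  linarith

/-! ### The edgeless skeleton and THEOREM R -/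

/-- On the edgeless skeleton `(P) = N_c(∅)·Δ(x c, K c)`: the probe's own slack. -/
theorem pFun_empty (c : V) (x K : V → ℝ) :
    G.pFun c x K (∅ : Finset E) =
      G.nbarOff x c (fun _ => false) * slackOne (x c) (K c) := by
  unfold pFun
  rw [configsIn_empty, Finset.sum_singleton]
  have hcl : G.clusterF (fun _ : E => false) c = {c} :=
    clusterF_eq_singleton_of_forall_false (fun _ => rfl) c
  have hx : G.xCluster x c (fun _ => false) = x c := by
    unfold xCluster
    rw [hcl, Finset.prod_singleton]
  have hK : G.kCluster K c (fun _ => false) = K c := by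
    unfold kCluster
    rw [hcl, Finset.prod_singleton]
  have hcompl : complIn (∅ : Finset E) (fun _ : E => false) = fun _ => false := by
    funext f
    simp [complIn]
  rw [hcompl, nbar_eq_mul_nbarOff G x c, hx, hK]
  unfold slackOne
  ring

variable (G) in
/-- **EM(corner)** (mine-3 §29 (c)): for every edge set `F`, every `e ∈ F` and every `x ∈ [0, 1]^V`,
the (P) functional at the lower-corner state `K = K_min ∘ x` does not decrease when `e` is added. -/
def EMCorner (c : V) : Prop :=
  ∀ (F : Finset E) (e : E), e ∈ F → ∀ x : V → ℝ, (∀ v, 0 ≤ x v ∧ x v ≤ 1) →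
    G.pFun c x (fun v => kMin (x v)) (F.erase e) ≤ G.pFun c x (fun v => kMin (x v)) F

/-- **THEOREM R (mine-3 §29 (c))**: EM(corner) implies CONJECTURE (P) on the skeleton:
`(P_F) ≥ 0` for every edge set `F` and every band state (`x ∈ [0, 1]`, `K ≥ K_min(x)`). -/
theorem pFun_nonneg_of_emCorner {c : V} (hEM : G.EMCorner c) (F : Finset E) :
    ∀ x K : V → ℝ, (∀ v, 0 ≤ x v ∧ x v ≤ 1) → (∀ v, kMin (x v) ≤ K v) → 0 ≤ G.pFun c x K F := by
  induction F using Finset.induction_on with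
  | empty =>
    intro x K hx hK
    rw [pFun_empty]
    exact mul_nonneg (nbarOff_nonneg hx c _) (slackOne_nonneg_of_kMin_le (hx c).2 (hK c))
  | insert e F' he ih =>
    intro x K hx hK
    have hK₀ : ∀ v, 0 ≤ kMin (x v) := fun _ => le_max_left _ _
    have hF' : (insert e F').erase e = F' := Finset.erase_insert he
    have h1 : 0 ≤ G.pFun c x (fun v => kMin (x v)) F' := ih x _ hx fun v => le_rfl
    have h2 : 0 ≤ G.pFun c x K F' := ih x K hx hK
    have hEMe := hEM (insert e F') e (Finset.mem_insert_self e F') x hx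
    have hmono := pFun_halfEM_mono (G := G) (c := c) hx hK₀ hK (Finset.mem_insert_self e F')
    rw [hF'] at hEMe hmono
    linarith

/-- **THEOREM R at one edge (the cycle version of mine-3 §29 (c))**: if `(P_{F − e}) ≥ 0` at every
band state and `(P_F) ≥ (P_{F − e})` at every lower-corner state, then `(P_F) ≥ 0` at every band
state (no induction: `Φ_e ≥ ½(P_{F − e}) ≥ 0` at the corner, and `Φ_e` grows with the `K`-cells). -/
theorem pFun_nonneg_of_emCorner_at {c : V} {F : Finset E} {e : E} (he : e ∈ F)
    (hdel : ∀ x K : V → ℝ, (∀ v, 0 ≤ x v ∧ x v ≤ 1) → (∀ v, kMin (x v) ≤ K v) →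
      0 ≤ G.pFun c x K (F.erase e))
    (hEM : ∀ x : V → ℝ, (∀ v, 0 ≤ x v ∧ x v ≤ 1) →
      G.pFun c x (fun v => kMin (x v)) (F.erase e) ≤ G.pFun c x (fun v => kMin (x v)) F)
    {x K : V → ℝ} (hx : ∀ v, 0 ≤ x v ∧ x v ≤ 1) (hK : ∀ v, kMin (x v) ≤ K v) :
    0 ≤ G.pFun c x K F := by
  have hK₀ : ∀ v, 0 ≤ kMin (x v) := fun _ => le_max_left _ _
  have h1 : 0 ≤ G.pFun c x (fun v => kMin (x v)) (F.erase e) := hdel x _ hx fun _ => le_rfl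
  have h2 : 0 ≤ G.pFun c x K (F.erase e) := hdel x K hx hK
  have hEMe := hEM x hx
  have hmono := pFun_halfEM_mono (G := G) (c := c) hx hK₀ hK he
  linarith

/-! ### The Δ-form (mine-3 §29 (a)) -/

section DeltaForm

omit [Fintype V] [DecidableEq V] in
/-- The complement inside `F` of a configuration is a configuration inside `F`. -/
theorem complIn_mem_configsIn (F : Finset E) (ω : Config E) : complIn F ω ∈ configsIn F := by
  rw [mem_configsIn]
  intro e he
  simp only [complIn, decide_eq_true_eq] at he
  exact he.1

omit [Fintype V] [DecidableEq V] in
/-- Complementing twice inside `F` gives back a configuration inside `F`. -/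
theorem complIn_complIn {F : Finset E} {ω : Config E} (hω : ω ∈ configsIn F) :
    complIn F (complIn F ω) = ω := by
  funext e
  by_cases he : e ∈ F
  · cases h : ω e <;> simp [complIn, he, h]
  · have : ω e = false := by
      cases h : ω e
      · rfl
      · exact absurd ((mem_configsIn.1 hω) e h) he
    simp [complIn, he, this]

omit [Fintype V] [DecidableEq V] in
/-- Complementation inside `F` is a bijection of the configurations inside `F`. -/
theorem sum_complIn_eq (F : Finset E) (f : Config E → ℝ) :
    ∑ ω ∈ configsIn F, f (complIn F ω) = ∑ ω ∈ configsIn F, f ω :=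
  Finset.sum_nbij' (complIn F) (complIn F) (fun ω _ => complIn_mem_configsIn F ω)
    (fun ω _ => complIn_mem_configsIn F ω) (fun _ hω => complIn_complIn hω)
    (fun _ hω => complIn_complIn hω) (fun _ _ => rfl)

/-- **The Δ-form of `(P)`** (mine-3 §29 (a)): `(P_F) = ∑_{ω ⊆ F} N_c(ω)·Δ(X_c(ω), K_c(ω^c))` —
every summand is the one-state slack of the glued state of `c`'s cluster, except that the
`K`-product is taken over `c`'s cluster in the COMPLEMENTARY configuration. -/
theorem pFun_eq_sum_slackOne (c : V) (x K : V → ℝ) (F : Finset E) :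
    G.pFun c x K F = ∑ ω ∈ configsIn F,
      G.nbarOff x c ω * slackOne (G.xCluster x c ω) (G.kCluster K c (complIn F ω)) := by
  rw [pFun_eq_pFunLin_add_pFunK]
  unfold pFunLin pFunK
  have hswap : ∑ ω ∈ configsIn F, G.kCluster K c ω * G.nbar x (complIn F ω) =
      ∑ ω ∈ configsIn F, G.kCluster K c (complIn F ω) * G.nbar x ω := by
    rw [← sum_complIn_eq F (fun ω => G.kCluster K c (complIn F ω) * G.nbar x ω)]
    refine Finset.sum_congr rfl fun ω hω => ?_
    rw [complIn_complIn hω]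
  rw [hswap, ← Finset.sum_add_distrib]
  refine Finset.sum_congr rfl fun ω _ => ?_
  rw [nbar_eq_mul_nbarOff G x c]
  unfold slackOne
  ring

end DeltaForm

end MultiGraph

end PercRepro
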